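import Literature.MathematicalPhysics.KineticTheory.HardSphereEulerProofs

/-!
# Stub `stub_oneSiteGauss` of the line `Sketch` (doubling RG) for the crux
`TwoClocks.EquilibriumFastWindowLD` (stmt-AtomisticToContinuum-14440)

One-site Gaussian bound for centred observables of quadratic growth: under the isotropic
Gaussian `N(u, θ id) = gaussMeasure u θ` on `ℝ³`, every measurable `g` with
`|g(v)| ≤ C (1 + |v|²)` which is centred against the local Maxwellian `M_{1,u,θ}` satisfies
`∫⁻ exp (t g) dN(u, θ id) ≤ exp (K t²)` for `|t| ≤ t₀`, with `t₀ > 0` and `K ≥ 0` depending only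
on `C, θ, u` (not on `g`).

Proof: the global second-order bound `exp y ≤ 1 + y + y² exp |y|`, the centring
`∫ g dN(u, θ id) = ∫ g M_{1,u,θ} dv = 0` (`withDensity_localMaxwellian_eq_gaussMeasure`), and the
remainder `t² g² exp |t g| ≤ t² C² (1 + |v|²)² exp (t₀ C (1 + |v|²)) ≤ t² D exp (a |v|²)` priced
by Fernique's theorem (`IsGaussian.exists_integrable_exp_sq`) once `t₀ C ≤ a / 2`; finally
`1 + D I t² ≤ exp (D I t²)`.
-/

noncomputable section

open MeasureTheory ProbabilityTheory Real Set Filter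
open scoped ENNReal BigOperators

namespace Summit.AtomisticToContinuum.HydrodynamicLimit.Theorems.FastWindowRG

open Literature.Analysis.FluidPDE Literature.MathematicalPhysics.KineticTheory

/-- Global second-order bound for the real exponential: `exp y ≤ 1 + y + y² exp |y|`. -/
private theorem exp_le_one_add_add_sq_mul_exp_abs (y : ℝ) :
    Real.exp y ≤ 1 + y + y ^ 2 * Real.exp |y| := by
  have h1 : 1 ≤ Real.exp |y| := Real.one_le_exp (abs_nonneg y)
  rcases le_or_gt |y| 1 with hy | hy
  · have h := Real.abs_exp_sub_one_sub_id_le hy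
    have h2 : Real.exp y - 1 - y ≤ y ^ 2 := (le_abs_self _).trans h
    nlinarith [sq_nonneg y]
  · have hy2 : 1 ≤ y ^ 2 := by nlinarith [sq_abs y, abs_nonneg y]
    rcases le_or_gt 0 y with hy0 | hy0
    · rw [abs_of_nonneg hy0] at h1 ⊢
      nlinarith [Real.exp_pos y]
    · rw [abs_of_neg hy0] at h1 ⊢
      have h3 : Real.exp y ≤ 1 := Real.exp_le_one_iff.mpr hy0.le
      have h4 : -y + 1 ≤ Real.exp (-y) := Real.add_one_le_exp (-y)
      nlinarith [mul_le_mul hy2 h4 (by linarith) (sq_nonneg y)]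

/-- `z² ≤ 2 exp z` for `z ≥ 0`. -/
private theorem sq_le_two_mul_exp {z : ℝ} (hz : 0 ≤ z) : z ^ 2 ≤ 2 * Real.exp z := by
  have := Real.quadratic_le_exp_of_nonneg hz
  nlinarith

/-- Centring transfer: integration against `gaussMeasure u θ` is integration against the local
Maxwellian density `M_{1,u,θ}` (`withDensity_localMaxwellian_eq_gaussMeasure`). -/
private theorem integral_gaussMeasure_eq_integral_mul_localMaxwellian {θ : ℝ} (hθ : 0 < θ)
    (u : V3) (g : V3 → ℝ) :
    ∫ v, g v ∂(gaussMeasure u θ) = ∫ v, g v * localMaxwellian 1 θ u v := by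
  rw [← withDensity_localMaxwellian_eq_gaussMeasure hθ u,
    integral_withDensity_eq_integral_toReal_smul₀
      (continuous_localMaxwellian 1 θ u).measurable.ennreal_ofReal.aemeasurable
      (Eventually.of_forall fun _ => ENNReal.ofReal_lt_top)]
  refine integral_congr_ae (Eventually.of_forall fun v => ?_)
  simp only
  rw [ENNReal.toReal_ofReal (localMaxwellian_nonneg zero_le_one hθ.le u v), smul_eq_mul, mul_comm]

/-- **S2 `stub_oneSiteGauss`** (Gaussian analysis). Under `N(u, θ id) = gaussMeasure u θ`, every
measurable `g` with `|g(v)| ≤ C(1 + |v|²)` and `∫ g M_{1,u,θ} dv = 0` has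
`∫⁻ exp(t g) dN(u, θ id) ≤ exp(K t²)` for `|t| ≤ t₀`, with `t₀ > 0`, `K ≥ 0` depending only on
`C, θ, u` (Taylor to second order with the remainder priced by a Fernique-type Gaussian moment). -/
theorem stub_oneSiteGauss {θ : ℝ} (hθ : 0 < θ) (u : V3) {C : ℝ} (hC : 0 ≤ C) :
    ∃ t₀ : ℝ, 0 < t₀ ∧ ∃ K : ℝ, 0 ≤ K ∧ ∀ g : V3 → ℝ, Measurable g →
      (∀ v, |g v| ≤ C * (1 + ‖v‖ ^ 2)) → (∫ v, g v * localMaxwellian 1 θ u v = 0) →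
      ∀ t : ℝ, |t| ≤ t₀ →
        ∫⁻ v, ENNReal.ofReal (Real.exp (t * g v)) ∂(gaussMeasure u θ) ≤
          ENNReal.ofReal (Real.exp (K * t ^ 2)) := by
  -- Fernique: a Gaussian moment `∫ exp (a |v|²) dN(u, θ id) < ∞` for some `a > 0`
  obtain ⟨a, ha, hInt⟩ := IsGaussian.exists_integrable_exp_sq (gaussMeasure u θ)
  have hI0 : 0 ≤ ∫ v, Real.exp (a * ‖v‖ ^ 2) ∂(gaussMeasure u θ) :=
    integral_nonneg fun v => (Real.exp_pos _).le
  -- the constants: `t₀ C ≤ a / 2`, `D = 8 C² e^a / a²`, `K = D I`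
  have ht₀pos : 0 < a / (2 * (C + 1)) := by positivity
  have ht₀C : a / (2 * (C + 1)) * C ≤ a / 2 := by
    rw [div_mul_eq_mul_div, div_le_div_iff₀ (by positivity) (by positivity)]
    nlinarith
  have hD0 : 0 ≤ C ^ 2 * (8 / a ^ 2) * Real.exp a := by positivity
  refine ⟨a / (2 * (C + 1)), ht₀pos,
    C ^ 2 * (8 / a ^ 2) * Real.exp a * ∫ v, Real.exp (a * ‖v‖ ^ 2) ∂(gaussMeasure u θ),
    mul_nonneg hD0 hI0, ?_⟩
  intro g hg hgC hg0 t ht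
  set D : ℝ := C ^ 2 * (8 / a ^ 2) * Real.exp a with hD
  set I : ℝ := ∫ v, Real.exp (a * ‖v‖ ^ 2) ∂(gaussMeasure u θ) with hI
  have habs_t : |t| * C ≤ a / 2 := (mul_le_mul_of_nonneg_right ht hC).trans ht₀C
  -- pointwise bound on `|t g v|`
  have htg : ∀ v : V3, |t * g v| ≤ a / 2 * (1 + ‖v‖ ^ 2) := fun v => by
    rw [abs_mul]
    calc |t| * |g v| ≤ |t| * (C * (1 + ‖v‖ ^ 2)) :=
          mul_le_mul_of_nonneg_left (hgC v) (abs_nonneg t)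
      _ = |t| * C * (1 + ‖v‖ ^ 2) := by ring
      _ ≤ a / 2 * (1 + ‖v‖ ^ 2) := mul_le_mul_of_nonneg_right habs_t (by positivity)
  -- integrability of `g` (dominated by a multiple of the Fernique weight)
  have hg_int : Integrable g (gaussMeasure u θ) := by
    refine Integrable.mono' (hInt.const_mul (C * (1 + a⁻¹))) hg.aestronglyMeasurable
      (Eventually.of_forall fun v => ?_)
    have h1 : a * ‖v‖ ^ 2 + 1 ≤ Real.exp (a * ‖v‖ ^ 2) := Real.add_one_le_exp _
    have h2 : 1 ≤ Real.exp (a * ‖v‖ ^ 2) := Real.one_le_exp (by positivity)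
    have h3 : 1 + ‖v‖ ^ 2 ≤ (1 + a⁻¹) * Real.exp (a * ‖v‖ ^ 2) := by
      rw [add_mul, one_mul]
      have : ‖v‖ ^ 2 ≤ a⁻¹ * Real.exp (a * ‖v‖ ^ 2) := by
        rw [inv_mul_eq_div, le_div_iff₀ ha]
        linarith
      linarith
    rw [Real.norm_eq_abs]
    calc |g v| ≤ C * (1 + ‖v‖ ^ 2) := hgC v
      _ ≤ C * ((1 + a⁻¹) * Real.exp (a * ‖v‖ ^ 2)) := mul_le_mul_of_nonneg_left h3 hC
      _ = C * (1 + a⁻¹) * Real.exp (a * ‖v‖ ^ 2) := by ring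
  -- centring under `gaussMeasure`
  have hg0' : ∫ v, g v ∂(gaussMeasure u θ) = 0 := by
    rw [integral_gaussMeasure_eq_integral_mul_localMaxwellian hθ u g]
    exact hg0
  -- pointwise second-order bound for `exp (t g)`
  have hpt : ∀ v : V3, Real.exp (t * g v) ≤
      1 + t * g v + t ^ 2 * (D * Real.exp (a * ‖v‖ ^ 2)) := fun v => by
    have h := exp_le_one_add_add_sq_mul_exp_abs (t * g v)
    have hsq : (g v) ^ 2 ≤ C ^ 2 * (1 + ‖v‖ ^ 2) ^ 2 := by
      rw [← sq_abs, ← mul_pow]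
      exact pow_le_pow_left₀ (abs_nonneg _) (hgC v) 2
    have hexp : Real.exp |t * g v| ≤ Real.exp (a / 2 * (1 + ‖v‖ ^ 2)) :=
      Real.exp_le_exp.2 (htg v)
    have hpoly : (1 + ‖v‖ ^ 2) ^ 2 ≤ 8 / a ^ 2 * Real.exp (a / 2 * (1 + ‖v‖ ^ 2)) := by
      have hz : 0 ≤ a / 2 * (1 + ‖v‖ ^ 2) := by positivity
      have h2 := sq_le_two_mul_exp hz
      rw [div_mul_eq_mul_div, le_div_iff₀ (by positivity)]
      nlinarith [h2]
    have hee : Real.exp (a / 2 * (1 + ‖v‖ ^ 2)) * Real.exp (a / 2 * (1 + ‖v‖ ^ 2)) =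
        Real.exp a * Real.exp (a * ‖v‖ ^ 2) := by
      rw [← Real.exp_add, ← Real.exp_add]
      congr 1
      ring
    have key : (g v) ^ 2 * Real.exp |t * g v| ≤ D * Real.exp (a * ‖v‖ ^ 2) := by
      calc (g v) ^ 2 * Real.exp |t * g v|
          ≤ C ^ 2 * (1 + ‖v‖ ^ 2) ^ 2 * Real.exp (a / 2 * (1 + ‖v‖ ^ 2)) :=
            mul_le_mul hsq hexp (Real.exp_pos _).le (by positivity)
        _ ≤ C ^ 2 * (8 / a ^ 2 * Real.exp (a / 2 * (1 + ‖v‖ ^ 2))) *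
              Real.exp (a / 2 * (1 + ‖v‖ ^ 2)) := by gcongr
        _ = C ^ 2 * (8 / a ^ 2) *
              (Real.exp (a / 2 * (1 + ‖v‖ ^ 2)) * Real.exp (a / 2 * (1 + ‖v‖ ^ 2))) := by ring
        _ = D * Real.exp (a * ‖v‖ ^ 2) := by rw [hee, hD]; ring
    calc Real.exp (t * g v) ≤ 1 + t * g v + (t * g v) ^ 2 * Real.exp |t * g v| := h
      _ = 1 + t * g v + t ^ 2 * ((g v) ^ 2 * Real.exp |t * g v|) := by ring
      _ ≤ 1 + t * g v + t ^ 2 * (D * Real.exp (a * ‖v‖ ^ 2)) := by gcongr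
  -- integrability of `exp (t g)` (dominated by `e^{a/2}` times the Fernique weight)
  have hexp_int : Integrable (fun v => Real.exp (t * g v)) (gaussMeasure u θ) := by
    refine Integrable.mono' (hInt.const_mul (Real.exp (a / 2)))
      ((hg.const_mul t).exp).aestronglyMeasurable (Eventually.of_forall fun v => ?_)
    rw [Real.norm_eq_abs, abs_of_pos (Real.exp_pos _)]
    have hs : 0 ≤ ‖v‖ ^ 2 := by positivity
    calc Real.exp (t * g v) ≤ Real.exp |t * g v| := Real.exp_le_exp.2 (le_abs_self _)
      _ ≤ Real.exp (a / 2 * (1 + ‖v‖ ^ 2)) := Real.exp_le_exp.2 (htg v)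
      _ ≤ Real.exp (a / 2) * Real.exp (a * ‖v‖ ^ 2) := by
          rw [← Real.exp_add]
          exact Real.exp_le_exp.2 (by nlinarith [ha.le, hs])
  -- integrate the pointwise bound
  have h1g : Integrable (fun v => 1 + t * g v) (gaussMeasure u θ) :=
    (integrable_const 1).add (hg_int.const_mul t)
  have hDw : Integrable (fun v => t ^ 2 * (D * Real.exp (a * ‖v‖ ^ 2))) (gaussMeasure u θ) :=
    (hInt.const_mul D).const_mul (t ^ 2)
  have hint_le : ∫ v, Real.exp (t * g v) ∂(gaussMeasure u θ) ≤ 1 + D * I * t ^ 2 := by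
    calc ∫ v, Real.exp (t * g v) ∂(gaussMeasure u θ)
        ≤ ∫ v, (1 + t * g v + t ^ 2 * (D * Real.exp (a * ‖v‖ ^ 2))) ∂(gaussMeasure u θ) :=
          integral_mono hexp_int (h1g.add hDw) hpt
      _ = 1 + t * ∫ v, g v ∂(gaussMeasure u θ) + t ^ 2 * (D * I) := by
          rw [integral_add h1g hDw, integral_add (integrable_const 1) (hg_int.const_mul t),
            integral_const_mul, integral_const_mul, integral_const_mul, integral_const, hI]
          simp
      _ = 1 + D * I * t ^ 2 := by rw [hg0']; ring
  -- back to the `lintegral`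
  rw [← ofReal_integral_eq_lintegral_ofReal hexp_int
    (Eventually.of_forall fun v => (Real.exp_pos _).le)]
  refine ENNReal.ofReal_le_ofReal (hint_le.trans ?_)
  have := Real.add_one_le_exp (D * I * t ^ 2)
  linarith

end Summit.AtomisticToContinuum.HydrodynamicLimit.Theorems.FastWindowRG
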